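import Summits.MatrixMultiplication.OmegaCensus.STPPSmallPatternWitnesses
import Summits.MatrixMultiplication.OmegaCensus.STPPFatQuotientLift
import Summits.MatrixMultiplication.OmegaCensus.STPPSmallPatternLawBridge
import Summits.MatrixMultiplication.OmegaCensus.STPPSmallPatternCyclicThreeAPFreeRungs

/-!
# ω-census, `(1,2,2)¹³` host law «order ≥ 252»: the last seed type — `ℤ/11 × ℤ/5 × ℤ/5` (order 275) HOSTS `(1,2,2)¹³` (kit GO #156 decide witness)

`ℤ/11 × ℤ/5 × ℤ/5` was the only seed type of the `252` plan (ENG2's cyclic ray start) without a `(1,2,2)¹³` family, which is why the k = 13 law first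
landed at `276` (`…T2K13Law`): odd order (no fat lift), not a product (`4 · 3 < 13`), desk and kit GO #144 random restarts blank.  Kit GO #156 j330732 (lead
unit; g25's `find122.py`, 1 356 s; bundle of seat stpp-3 gen 27) found the family below; it is re-checked literally in-job, by the lead's code-disjoint leg, and
here by `decide`.  With it the law re-files at `252` (`…T2K13N252Law`).

HONEST FRAMING (pub-omega census; verbatim): lottery ticket; floor = certified bounds/negative ranges.
Census STRUCTURE bookkeeping of the STPP track (seat pub-omega-stpp-3, gen 27; STRUCTURE row B5, columns `T1`/`T2`, §2 C10 row 13), not progress on `ω`: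
small patterns in small groups bound no exponent.

References: H. Cohn, R. Kleinberg, B. Szegedy, C. Umans, FOCS 2005 (arXiv:math/0511460), Def. 5.1.  Records: HOME `pub-omega-stpp-3-g28/work/t2k13/` (generator `code/k28/mk_residual13.py`, gen 27/28).
-/

open Literature.Computability.AlgebraicComplexity Finset

namespace Summit.MatrixMultiplication.OmegaCensus

/-- **`(1,2,2)¹³ ⊆ ℤ/11 × ℤ/5 × ℤ/5`** (order `275`; kit GO #156 j330732 (lead unit, 'stpp3-open-cells', 16 c × 2 h) find by g25's `find122.py` in 1 356 s, literal Def-5.1 re-check). [cite: CohnKleinbergSzegedyUmans2005, Def. 5.1] -/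
theorem exists_isSTPP_122pow13_seed_11_5_5 :
    ∃ A B C : Fin 13 → Finset (ZMod 11 × ZMod 5 × ZMod 5), IsSTPP A B C ∧ ∀ i, (A i).card = 1 ∧ (B i).card = 2 ∧ (C i).card = 2 :=
  exists_isSTPP_of_lists_cards (H := ZMod 11 × ZMod 5 × ZMod 5)
    ![[(0, 0, 0)], [(0, 0, 0)], [(0, 0, 0)], [(0, 0, 0)], [(0, 0, 0)], [(0, 0, 0)], [(0, 0, 0)], [(0, 0, 0)], [(0, 0, 0)], [(0, 0, 0)], [(0, 0, 0)], [(0, 0, 0)], [(0, 0, 0)]]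
    ![[(0, 0, 0), (0, 0, 1)], [(0, 1, 0), (0, 1, 1)], [(0, 3, 0), (0, 3, 1)], [(1, 1, 0), (1, 1, 1)], [(2, 0, 0), (2, 0, 1)], [(2, 1, 0), (2, 1, 1)], [(2, 3, 0), (2, 3, 1)], [(3, 1, 0), (3, 1, 1)], [(6, 0, 0), (6, 2, 0)], [(6, 0, 1), (7, 4, 1)], [(6, 0, 2), (6, 2, 2)], [(6, 0, 4), (6, 2, 4)], [(6, 2, 3), (7, 1, 3)]]
    ![[(0, 0, 0), (0, 0, 2)], [(0, 2, 0), (0, 2, 2)], [(1, 0, 0), (1, 0, 2)], [(1, 4, 0), (1, 4, 2)], [(4, 0, 0), (4, 0, 2)], [(4, 2, 0), (4, 2, 2)], [(5, 0, 0), (5, 0, 2)], [(5, 4, 0), (5, 4, 2)], [(8, 4, 3), (9, 3, 3)], [(9, 0, 4), (10, 1, 4)], [(6, 4, 0), (7, 3, 0)], [(10, 0, 2), (10, 4, 2)], [(7, 1, 1), (9, 1, 1)]]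
    (by decide +kernel) (by decide +kernel)

end Summit.MatrixMultiplication.OmegaCensus
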